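import Literature.NumberTheory.Rogawski1990.LocalTransferIdentityCoreResidualStatementsOdd
import Literature.NumberTheory.Rogawski1990.ShalikaGermExpansionUnitaryThreeNonsplitCM
import HarnessLib

/-!
# [Rogawski1990, §8.1 Prop. 8.1.1] «SHALIKA AT `Φ₃`, ODD NON-SPLIT PLACES» — DISCHARGED: `n6nsShalikaOddStatement_holds`

Kernel-lane companion of ★ `Literature/NumberTheory/Rogawski1990/LocalTransferIdentityCoreResidualStatementsOdd.lean`: its named fact
★ `N6nsShalikaOddStatement` (the Shalika germ expansion at the identity for the quasi-split `U(Φ₃)(L⁺_v)` at every non-split place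
`v ∤ 2`, the narrowed row of the cell's letter «N6ns-Shalika») is PROVED here, on the Literature side, by composing two tree theorems:

* ★ `n6nsShalikaStatement_holds : N6nsShalikaStatement` (`ShalikaGermExpansionUnitaryThreeNonsplitCM.lean` §5: the row of record, at
  EVERY non-split place, proved in-house from Harish-Chandra's germ expansion with Howe's finiteness and Ranga Rao's orbital measures), and
* ★ `n6nsShalikaOddStatement_of_n6nsShalikaStatement : N6nsShalikaStatement → N6nsShalikaOddStatement` (drop the parity hypothesis).

The summit side proves the same statement as `Summits/HodgeConjecture/…/Theorems/F0P3cN6nsShalikaOdd.lean :: n6nsShalikaOdd`; the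
Literature-side discharge was missing, so the fact still counted as unproved in `Literature/`.  THEOREMS ONLY (no definition, no named
fact, no `sorry`, no instance, no notation); cell hodgecm-mathlib, seat B-typ01 (g33); net debt −1.

## References
* [Rogawski1990] J. Rogawski, *Automorphic representations of unitary groups in three variables*, Ann. of Math. Stud. 123 (1990),
  §8.1 Prop. 8.1.1 pp. 112–113.
* [HarishChandra1999AdmissibleDistributions] Harish-Chandra, *Admissible invariant distributions on reductive p-adic groups* (notes by
  S. DeBacker, P. Sally), AMS University Lecture Series 16 (1999), Thm. 8.1 p. 48.
-/

namespace Literature.NumberTheory.Rogawski1990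

/-- ★ `N6nsShalikaOddStatement` HOLDS ([Rogawski1990, Prop. 8.1.1]: the Shalika germ expansion for `U(Φ₃)(L⁺_v)` at every non-split place
`v ∤ 2` of the CM field `L`): the all-places row ★ `n6nsShalikaStatement_holds` with the parity hypothesis dropped
(★ `n6nsShalikaOddStatement_of_n6nsShalikaStatement`). [cite: Rogawski1990, §8.1 Prop. 8.1.1 p. 112] [cite: HarishChandra1999AdmissibleDistributions, Thm. 8.1 p. 48] -/
theorem n6nsShalikaOddStatement_holds : N6nsShalikaOddStatement :=
  n6nsShalikaOddStatement_of_n6nsShalikaStatement n6nsShalikaStatement_holds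

end Literature.NumberTheory.Rogawski1990
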